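/-
Copyright: the b2b-balaban T⁴-continuum CRUX team, row NE7b, leaf lineage `t4-ne7b-formalise-leaf-02` (gen 132). Project licence.
-/
import Literature.MathematicalPhysics.QuantumFieldTheory.Balaban1983to89.B7Prop3GeneralLinearBound
import Summits.QuantumFields.BalabanUV.T4Continuum.Spine.NE7b.NonAbelianStokesBound

/-!
# LEMMA CS (ii) AT ONE STEP, AGAINST [B7]'s TYPED MAIN TERM (125): the covariant coarse curl of `Q₀A` over a coarse plaquette `P` IS the block
# average over `x ∈ B(c₋)` of the rotated boundary sums of the `L × L` squares `S_x(P)` — EXACTLY, up to three transport discrepancies per block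
# point, each a conjugation by a displayed closed-loop letter; hence `|(∂_V Q₀A)(P)| ≤ Σ_x L^{−(d+1)}·(‖(R_{0,x}A)(∂S_x(P))‖ + 2δ·Σ_{b∈∂S_x(P)}‖A_b‖)`
# (row NE7b, node U5c; the (h1) slot of print's `γ₀` assembly, `SectE-interface-proof.md` §5.2 Lemma CS step (ii): «the four `M_k`-terms entering
# `(∂_V M_kA)(P)` are, after re-indexing the base points of the four blocks … exactly the four sides of `∂S_x(P)` averaged over `x ∈ B^k(y)`, EXCEPT that
# each bond carries the transport `Ad(V(·)W_{x′,t})` instead of `Ad(U(γ_{x→b}))` … hence `|Ad(·) − Ad(·)| ≤ 2|· − ·| ≤ c_g ε_F`» — its `k = 1` instance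
# as a theorem of the tree's [B7] objects, the loop letters DISPLAYED; step (i) — the boundary sum IS the surface sum of transported curls up to curvature —
# is leaf-05's `LinearisedLatticeStokesRectangle.norm_rectWord_sub_sum_le`, read on `(R_{0,x}A)(∂S_x)` through this lineage's `…RotatedSumPairHolonomy`)

Cell `pub-balaban`, sub-cell `t4`, spine estimate NE7b (`T4WeightBudget.RelWeightBound`; the cell's OWN estimate — NOT PRINTED in
[Bałaban 1983–89], NOT PROVED).  Crux-route work under `Spine/NE7b/` by the row's E-side ∕ key-readings ∕ lattice-geometry leaf lineage; NOTHING
of Bałaban's is asserted beyond what the imported Literature modules define and prove; no `T4Continuum/Support` leaf typed; no `def`, no notation;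
zero `sorry`.  Imports (hub oleans present), REUSED BY NAME: `Literature.….B7Prop3GeneralLinearBound` (through it `B7Prop3GeneralLinear.Q0cov` = (125),
`B7Prop3GeneralRotated.tsum ∕ tsum_append ∕ norm_tsum_le ∕ norm_conjR_le ∕ conjR_mul_left`, `B7Prop3GeneralLinearSplit.tsum_revWord ∕ conjR_sum`,
`B7Prop3GeneralLinearBound.norm_conjR_sub_self_le`, `B7Prop1Explicit.hol ∕ seg ∕ revWord ∕ treeWord ∕ boxVec ∕ U1 ∕ hol_mem`,
`B7Eq78Linearization.conjR`) and leaf-05's `…NonAbelianStokesBound` (`rectWord κ μ n m = seg κ n ++ seg μ m ++ revWord (seg κ n) ++ revWord (seg μ m)`).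

WHY (located).  After `…CovariantStokesCounting` ∕ `…BlockSurfaceMultiplicity` ∕ `…BlockSurfaceCounting` (the counting (iii)), `…AveragedCurlFormSplit`
(the `M ∕ E` split), `…OneStepAveragingRemainder` (the (R-M) letter at `k = 1`) and `…RotatedSumPairHolonomy` (the dictionary), the (h1) slot's
MAIN-PART letter still displays Lemma CS's per-plaquette bound `|X_M(P)| ≤ Σ_x w_x (a_{P,x} + ε·Σ_{b∈∂S_x(P)} v|A_b|)` — the `hX` of
`CovariantStokesCounting.sum_sq_le_of_blockAverage_bound`.  THIS FILE proves its step (ii) at `k = 1` for [B7]'s typed objects: the fine 1-form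
`A`, the fine background `V₀` (unit-ball units), the main term `(Q₀A)_c = Σ_{x∈B(c₋)} L^{−(d+1)} R(V₀(Γ_{c₋,x}))(R_{0,x}A)([x, x+Le_κ])` (125) on the
coarse bonds `c = ⟨q, q + Le_κ⟩` (fine base points `q, q + Le_κ, q + Le_μ` of the coarse plaquette `P = (q; κ, μ)`), and ANY coarse bond variables
`u₁ = V(c₁), u₂ = V(c₂), u₃ = V(c₃), u₄ = V(c₄)` in the unit ball (print: `V = Ū`; the identity is pure algebra in the `uᵢ`).

WHAT IS PROVED ([folklore] algebra + triangle inequalities over the tree's [B7] objects; `𝔸` a complete normed `ℂ`-algebra, `‖1‖ = 1`):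
* §1 bookkeeping (`R(u)` through finite sums is the tree's `B7Prop3GeneralLinearSplit.conjR_sum`, BY NAME): `norm_conjR_sub_conjR_le` (**two transports of one element differ by the loop**:
  `a, b ∈ U1`, `‖b⁻¹a − 1‖ ≤ δ` ⊢ `‖R(a)S − R(b)S‖ ≤ 2δ‖S‖` — [B7]-currency twin of `LinearisedLatticeStokesRectangle.sz_transport_quotient_le`),
  `norm_tsum_seg_le_sum` (`‖(R_{0,x}A)([x, x+ne_κ])‖ ≤ Σ_{i<n} ‖A(x+ie_κ, κ)‖`).
* §2 **`tsum_rectWord`** — THE ROTATED BOUNDARY SUM OF A RECTANGLE IN FOUR SIDES: `(R_{0,x}A)(∂R_{n,m}) = S₁ + R(t₁)S₂ − R(t₁t₂t₃⁻¹)S₃ − R(t₁t₂t₃⁻¹t₄⁻¹)S₄`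
  with the side sums `S₁ = (R_{0,x}A)([x, x+ne_κ])`, `S₂ = (R_{0,x+ne_κ}A)([·, ·+me_μ])`, `S₃ = (R_{0,x+me_μ}A)([·, ·+ne_κ])`, `S₄ = (R_{0,x}A)([x, x+me_μ])` and the
  side transports `t₁ … t₄` (`tsum_append` ×3, `tsum_revWord` ×2).
* §3 **`coarseCurl_Q0cov_eq_sum`** — LEMMA CS (ii), THE IDENTITY: the covariant coarse curl of the (125)-field,
  `X := (Q₀A)_{c₁} + R(u₁)(Q₀A)_{c₂} − R(u₁u₂u₃⁻¹)(Q₀A)_{c₃} − R(u₁u₂u₃⁻¹u₄⁻¹)(Q₀A)_{c₄}` (the additive reading of `LinearisedLatticeStokes.left_hol_plaqWord`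
  on the coarse lattice), equals `Σ_r L^{−(d+1)}·Y_r` with, at the block point `x_r = q + r`,
  `Y_r = R(g_r)S₁ʳ + R(u₁g′_r)S₂ʳ − R(u₁u₂u₃⁻¹g″_r)S₃ʳ − R(u₁u₂u₃⁻¹u₄⁻¹g_r)S₄ʳ` — the four sides of `∂S_{x_r}(P)` with [B7]'s transports (tree contours
  `g_r = V₀(Γ_{q,x_r})`, `g′_r = V₀(Γ_{q+Le_κ, x_r+Le_κ})`, `g″_r = V₀(Γ_{q+Le_μ, x_r+Le_μ})` then the coarse bonds): the re-indexing
  «`B(c₋ + Le_κ) = B(c₋) + Le_κ`» is the identity `(q + Le_κ) + r = (q + r) + Le_κ` on [B7]'s block offsets `r ∈ [0, L)^d`.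
* §4 **`norm_Y_sub_conjR_Z_le`** — LEMMA CS (ii), THE DISCREPANCY: against the rotated boundary sum `Z_r := (R_{0,x_r}A)(∂S_{x_r}(P))` transported by
  `g_r`, `‖Y_r − R(g_r)Z_r‖ ≤ 2(δ₂‖S₂ʳ‖ + δ₃‖S₃ʳ‖ + δ₄‖S₄ʳ‖)` where `δ₂, δ₃, δ₄` bound the three DISPLAYED closed-loop letters
  `‖(g_r t₁)⁻¹(u₁g′_r) − 1‖`, `‖(g_r t₁t₂t₃⁻¹)⁻¹(u₁u₂u₃⁻¹g″_r) − 1‖`, `‖(g_r t₁t₂t₃⁻¹t₄⁻¹)⁻¹(u₁u₂u₃⁻¹u₄⁻¹g_r) − 1‖` (each loop: coarse bond variables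
  vs fine transports around `≤ 2` blocks — small by (R-V) `B7Eq47AveragedBondVsStraight.norm_bavg_sub_straight_le_of_pdev` and the tree-contour
  curvature bounds of [B7] p. 25; NOT valued here).
* §5 **`norm_coarseCurl_Q0cov_le`** — LEMMA CS (ii) AT `k = 1`, THE BOUND: with `δ ≥ δ₂, δ₃, δ₄` uniformly in `r`,
  `‖X‖ ≤ Σ_r L^{−(d+1)}·(‖Z_r‖ + 2δ·(Σ_{i<L}‖A(x_r+Le_κ+ie_μ, μ)‖ + Σ_{i<L}‖A(x_r+Le_μ+ie_κ, κ)‖ + Σ_{i<L}‖A(x_r+ie_μ, μ)‖))` — VERBATIM the shape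
  `|X P| ≤ Σ_x w·(a + ε·Σ_{b∈T} v|A b|)` of `CovariantStokesCounting.sum_sq_le_of_blockAverage_bound` with `w = L^{−d}`, `v = L^{−1}`, `ε = 2δ`,
  `a_{P,x} = L^{−1}‖Z_r‖`, `T` ⊂ three sides of `∂S_{x_r}(P)`; `‖Z_r‖` is what step (i) bounds (`LinearisedLatticeStokesRectangle.norm_rectWord_sub_sum_le`
  through `RotatedSumPairHolonomy.toAdd_left_hol_eq_tsum`: `Z_r = toAdd (hol ⟨A,V₀⟩ x_r (rectWord κ μ L L)).left`).

NOT HERE (honest): the loop letters `δᵢ` BY VALUE ((R-V) + curvature; the tree has the ingredients, the assembly is a successor brick); step (i) and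
the counting (iii) (by name elsewhere, see above); `k > 1`; (R-M); the identification of `X` with the packet's coarse `(hol W^c y ∂P).left` (one
`left_hol_plaqWord` + dictionary away); the torus; normalisations `η`; which `𝔸`, `V = Ū`, `L` are Bałaban's ((A3) ∕ (A1c), NC-NE7b-α UNRULED).
BY-NAME EFFECT ON THE WALL: NONE (the (h1) slot's main-part letter at `k = 1` now displays only the loop letters `δᵢ`, the rectangle END (i) and the
counts; the wall is (R2)).  NE7b NOT PRINTED ∕ NOT PROVED; spine PROVED 0∕9; rung (B)+1 on a FINITE torus — NOT infinite volume, NOT the mass gap,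
NOT Clay.
HONEST DEPENDENCY: continuum YM on T⁴ ⇐ BetaPertH ∧ nine spine estimates (0/9 proved); BetaPertH ⇐ (D1) ∧ (D4) ∧ CAP+tail; G-an2-4 gates
asym, D1 and NE2/3/4.
-/

set_option autoImplicit false

noncomputable section

open scoped BigOperators
open Finset
open Literature.MathematicalPhysics.QuantumFieldTheory.Balaban1983to89
open Literature.MathematicalPhysics.QuantumFieldTheory.Balaban1983to89.B7Prop1Explicit
  (Site Letter e hol hol_append hol_revWord hol_revWord' seg seg_natCast revWord treeWord boxVec disp disp_seg disp_append
   disp_revWord U1 hol_mem stepHol_mem)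
open Literature.MathematicalPhysics.QuantumFieldTheory.Balaban1983to89.B7Eq78Linearization
  (conjR conjR_apply conjR_add conjR_sub conjR_smul_real)
open Literature.MathematicalPhysics.QuantumFieldTheory.Balaban1983to89.B7Prop3GeneralRotated
  (tsum tstep tsum_cons tsum_nil tsum_append norm_conjR_le conjR_mul_left)
open Literature.MathematicalPhysics.QuantumFieldTheory.Balaban1983to89.B7Prop3GeneralLinearSplit (tsum_revWord conjR_sum)
open Literature.MathematicalPhysics.QuantumFieldTheory.Balaban1983to89.B7Prop3GeneralLinear (Q0cov)
open Literature.MathematicalPhysics.QuantumFieldTheory.Balaban1983to89.B7Prop3GeneralLinearBound (norm_conjR_sub_self_le)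
open Summit.QuantumFields.BalabanUV.T4Continuum.NE7b.NonAbelianStokesBound (rectWord)

namespace Summit.QuantumFields.BalabanUV.T4Continuum.NE7b.OneStepCovariantStokes

variable {d : ℕ}
variable {𝔸 : Type*} [NormedRing 𝔸] [NormedAlgebra ℂ 𝔸] [NormOneClass 𝔸] [CompleteSpace 𝔸]

/-! ## §1 Bookkeeping: two transports differ by the loop; side sums are bounded by the bond sizes -/

section Bookkeeping

omit [NormedAlgebra ℂ 𝔸] [NormOneClass 𝔸] [CompleteSpace 𝔸] in
/-- `R(1) = id` (private bookkeeping, as in `B7Prop3GeneralLinearSplit`). [folklore] -/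
private theorem conjR_one_left (Y : 𝔸) : conjR (1 : 𝔸ˣ) Y = Y := by
  simp [conjR_apply]

omit [NormedAlgebra ℂ 𝔸] [NormOneClass 𝔸] [CompleteSpace 𝔸] in
/-- `R(X)(−Y) = −R(X)Y` (private bookkeeping; public twin `B8Eq146AExpansion.conjR_neg`, not imported). [folklore] -/
private theorem conjR_neg (X : 𝔸ˣ) (Y : 𝔸) : conjR X (-Y) = -conjR X Y := by
  simp [conjR_apply, mul_neg, neg_mul]

omit [NormedAlgebra ℂ 𝔸] [CompleteSpace 𝔸] in
/-- **TWO TRANSPORTS OF ONE ELEMENT DIFFER BY THE LOOP**: for `a, b ∈ U1` with `‖b⁻¹a − 1‖ ≤ δ`, `‖R(a)S − R(b)S‖ ≤ 2δ‖S‖`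
(`R(a)S − R(b)S = R(b)(R(b⁻¹a)S − S)`, `B7Prop3GeneralLinearBound.norm_conjR_sub_self_le`, `norm_conjR_le`) — the memo's «`|Ad(·) − Ad(·)| ≤ 2|· − ·|`».
[folklore] -/
theorem norm_conjR_sub_conjR_le {a b : 𝔸ˣ} (ha : a ∈ U1 𝔸) (hb : b ∈ U1 𝔸) {δ : ℝ}
    (hδ : ‖(((b⁻¹ * a : 𝔸ˣ)) : 𝔸) - 1‖ ≤ δ) (S : 𝔸) :
    ‖conjR a S - conjR b S‖ ≤ 2 * δ * ‖S‖ := by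
  have hmem : b⁻¹ * a ∈ U1 𝔸 := (U1 𝔸).mul_mem ((U1 𝔸).inv_mem hb) ha
  have hre : conjR a S - conjR b S = conjR b (conjR (b⁻¹ * a) S - S) := by
    rw [conjR_sub, ← conjR_mul_left, mul_inv_cancel_left]
  rw [hre]
  exact (norm_conjR_le hb _).trans (norm_conjR_sub_self_le hmem hδ S)

omit [NormedAlgebra ℂ 𝔸] [CompleteSpace 𝔸] in
/-- **SIDE SUMS ARE BOUNDED BY THE BOND SIZES**: `‖(R_{0,x}A)([x, x + ne_κ])‖ ≤ Σ_{i<n} ‖A(x + ie_κ, κ)‖` over a unit-ball background. [folklore] -/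
theorem norm_tsum_seg_le_sum {V₀ : Site d → Fin d → 𝔸ˣ} (hV₀ : ∀ x κ, V₀ x κ ∈ U1 𝔸) (A : Site d → Fin d → 𝔸) (κ : Fin d) :
    ∀ (n : ℕ) (x : Site d), ‖tsum V₀ A x (seg κ n)‖ ≤ ∑ i ∈ Finset.range n, ‖A (x + (i : ℤ) • e κ) κ‖
  | 0, x => by simp
  | n + 1, x => by
    rw [seg_natCast, List.replicate_succ, tsum_cons, ← seg_natCast, Finset.sum_range_succ']
    simp only [tstep, if_true, Letter.vec_true, Nat.cast_zero, zero_smul, add_zero]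
    refine (norm_add_le _ _).trans ?_
    rw [add_comm]
    refine add_le_add ?_ le_rfl
    refine (norm_conjR_le (stepHol_mem hV₀ x (κ, true)) _).trans ?_
    refine (norm_tsum_seg_le_sum hV₀ A κ n (x + e κ)).trans (le_of_eq ?_)
    refine Finset.sum_congr rfl fun i _ => ?_
    congr 2
    rw [Nat.cast_succ, add_smul, one_smul]
    abel

end Bookkeeping

/-! ## §2 The rotated boundary sum of a rectangle in four sides -/

section Rectangle

variable (V₀ : Site d → Fin d → 𝔸ˣ) (A : Site d → Fin d → 𝔸)

omit [NormedAlgebra ℂ 𝔸] [NormOneClass 𝔸] [CompleteSpace 𝔸] in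
/-- **THE ROTATED BOUNDARY SUM OF THE `n × m` RECTANGLE IN FOUR SIDES**: with `t₁ = V₀([x, x+ne_κ])`, `t₂ = V₀([x+ne_κ, ·+me_μ])`,
`t₃ = V₀([x+me_μ, ·+ne_κ])`, `t₄ = V₀([x, x+me_μ])` and the side sums `S₁ … S₄` (each a rotated straight-segment sum from the side's own base point):
`(R_{0,x}A)(∂R) = S₁ + R(t₁)S₂ − R(t₁t₂t₃⁻¹)S₃ − R(t₁t₂t₃⁻¹t₄⁻¹)S₄` — the four-segment analogue of `LinearisedLatticeStokes.left_hol_plaqWord`, in [B7]'s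
currency (`tsum_append`, `tsum_revWord`). [folklore] -/
theorem tsum_rectWord (x : Site d) (κ μ : Fin d) (n m : ℕ) :
    tsum V₀ A x (rectWord κ μ n m)
      = tsum V₀ A x (seg κ n)
        + conjR (hol V₀ x (seg κ n)) (tsum V₀ A (x + (n : ℤ) • e κ) (seg μ m))
        - conjR (hol V₀ x (seg κ n) * hol V₀ (x + (n : ℤ) • e κ) (seg μ m) * (hol V₀ (x + (m : ℤ) • e μ) (seg κ n))⁻¹)
            (tsum V₀ A (x + (m : ℤ) • e μ) (seg κ n))
        - conjR (hol V₀ x (seg κ n) * hol V₀ (x + (n : ℤ) • e κ) (seg μ m) * (hol V₀ (x + (m : ℤ) • e μ) (seg κ n))⁻¹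
              * (hol V₀ x (seg μ m))⁻¹)
            (tsum V₀ A x (seg μ m)) := by
  -- base points of the four sides
  have hb2 : x + disp (seg κ (n : ℤ)) = x + (n : ℤ) • e κ := by rw [disp_seg]
  have hb3 : x + disp (seg κ (n : ℤ) ++ seg μ (m : ℤ)) = (x + (m : ℤ) • e μ) + disp (seg κ (n : ℤ)) := by
    simp only [disp_append, disp_seg]; abel
  have hb4 : x + disp (seg κ (n : ℤ) ++ seg μ (m : ℤ) ++ revWord (seg κ (n : ℤ))) = x + disp (seg μ (m : ℤ)) := by
    simp only [disp_append, disp_revWord, disp_seg]; abel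
  -- holonomies of the prefixes
  have hh2 : hol V₀ x (seg κ (n : ℤ) ++ seg μ (m : ℤ)) = hol V₀ x (seg κ n) * hol V₀ (x + (n : ℤ) • e κ) (seg μ m) := by
    rw [hol_append, hb2]
  have hh3 : hol V₀ x (seg κ (n : ℤ) ++ seg μ (m : ℤ) ++ revWord (seg κ (n : ℤ)))
      = hol V₀ x (seg κ n) * hol V₀ (x + (n : ℤ) • e κ) (seg μ m) * (hol V₀ (x + (m : ℤ) • e μ) (seg κ n))⁻¹ := by
    rw [hol_append, hh2, hb3, hol_revWord]
  unfold rectWord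
  rw [tsum_append, hb4, tsum_revWord, hh3, tsum_append, hb3, tsum_revWord, hh2, tsum_append, hb2,
    conjR_neg, conjR_neg, ← conjR_mul_left, ← conjR_mul_left]
  abel

end Rectangle

/-! ## §3 Lemma CS (ii), the identity: the coarse curl of the (125)-field as ONE block average -/

section Identity

variable (L : ℕ) (V₀ : Site d → Fin d → 𝔸ˣ) (A : Site d → Fin d → 𝔸)

omit [NormOneClass 𝔸] [CompleteSpace 𝔸] in
/-- **LEMMA CS (ii) — THE IDENTITY.**  For the coarse plaquette `P = (q; κ, μ)` (fine base points `q`, `q + Le_κ`, `q + Le_μ` of its bonds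
`c₁ = ⟨q, q+Le_κ⟩`, `c₂ = ⟨q+Le_κ, ·+Le_μ⟩`, `c₃ = ⟨q+Le_μ, ·+Le_κ⟩`, `c₄ = ⟨q, q+Le_μ⟩`) and ANY coarse bond variables `u₁ … u₄`, the covariant
coarse curl of the main-term field (125), `(Q₀A)_{c₁} + R(u₁)(Q₀A)_{c₂} − R(u₁u₂u₃⁻¹)(Q₀A)_{c₃} − R(u₁u₂u₃⁻¹u₄⁻¹)(Q₀A)_{c₄}`, equals the block average
`Σ_r L^{−(d+1)}·Y_r` of the four transported side sums of `∂S_{x_r}(P)`, `x_r = q + r`. [folklore] -/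
theorem coarseCurl_Q0cov_eq_sum (q : Site d) (κ μ : Fin d) (u₁ u₂ u₃ u₄ : 𝔸ˣ) :
    Q0cov L V₀ A q κ + conjR u₁ (Q0cov L V₀ A (q + (L : ℤ) • e κ) μ)
      - conjR (u₁ * u₂ * u₃⁻¹) (Q0cov L V₀ A (q + (L : ℤ) • e μ) κ)
      - conjR (u₁ * u₂ * u₃⁻¹ * u₄⁻¹) (Q0cov L V₀ A q μ)
    = ∑ r : Fin d → Fin L, (((L : ℝ) ^ (d + 1))⁻¹) •
      ( conjR (hol V₀ q (treeWord (boxVec L r))) (tsum V₀ A (q + boxVec L r) (seg κ L))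
        + conjR (u₁ * hol V₀ (q + (L : ℤ) • e κ) (treeWord (boxVec L r)))
            (tsum V₀ A (q + boxVec L r + (L : ℤ) • e κ) (seg μ L))
        - conjR (u₁ * u₂ * u₃⁻¹ * hol V₀ (q + (L : ℤ) • e μ) (treeWord (boxVec L r)))
            (tsum V₀ A (q + boxVec L r + (L : ℤ) • e μ) (seg κ L))
        - conjR (u₁ * u₂ * u₃⁻¹ * u₄⁻¹ * hol V₀ q (treeWord (boxVec L r)))
            (tsum V₀ A (q + boxVec L r) (seg μ L)) ) := by
  unfold Q0cov
  rw [conjR_sum, conjR_sum, conjR_sum, ← Finset.sum_add_distrib, ← Finset.sum_sub_distrib,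
    ← Finset.sum_sub_distrib]
  refine Finset.sum_congr rfl fun r _ => ?_
  have e2 : q + (L : ℤ) • e κ + boxVec L r = q + boxVec L r + (L : ℤ) • e κ := by abel
  have e3 : q + (L : ℤ) • e μ + boxVec L r = q + boxVec L r + (L : ℤ) • e μ := by abel
  rw [e2, e3]
  simp only [conjR_smul_real, ← conjR_mul_left, mul_assoc, smul_add, smul_sub]

end Identity

/-! ## §4 Lemma CS (ii), the discrepancy: three transport comparisons per block point -/

section Discrepancy

variable {V₀ : Site d → Fin d → 𝔸ˣ} (hV₀ : ∀ x κ, V₀ x κ ∈ U1 𝔸) (A : Site d → Fin d → 𝔸)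

omit [NormedAlgebra ℂ 𝔸] [CompleteSpace 𝔸] in
include hV₀ in
/-- **LEMMA CS (ii) — THE DISCREPANCY AT ONE BLOCK POINT.**  At `x` (= `x_r`), with the side sums `S₁ … S₄` and side transports `t₁ … t₄` of
§2 for the `L × L` square `S_x(P)`, the tree-contour transports `g, g′, g″ ∈ U1` (print: `V₀(Γ_{q,x})`, `V₀(Γ_{q+Le_κ,x+Le_κ})`,
`V₀(Γ_{q+Le_μ,x+Le_μ})`) and coarse bond variables `u₁ … u₄ ∈ U1`: if the three closed-loop letters are bounded,
`‖(g t₁)⁻¹(u₁g′) − 1‖ ≤ δ₂`, `‖(g t₁t₂t₃⁻¹)⁻¹(u₁u₂u₃⁻¹g″) − 1‖ ≤ δ₃`, `‖(g t₁t₂t₃⁻¹t₄⁻¹)⁻¹(u₁u₂u₃⁻¹u₄⁻¹g) − 1‖ ≤ δ₄`, then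
`‖Y − R(g)·(R_{0,x}A)(∂S_x(P))‖ ≤ 2(δ₂‖S₂‖ + δ₃‖S₃‖ + δ₄‖S₄‖)`. [folklore] -/
theorem norm_Y_sub_conjR_Z_le (x : Site d) (κ μ : Fin d) (L : ℕ) {g g' g'' u₁ u₂ u₃ u₄ : 𝔸ˣ}
    (hg : g ∈ U1 𝔸) (hg' : g' ∈ U1 𝔸) (hg'' : g'' ∈ U1 𝔸)
    (hu₁ : u₁ ∈ U1 𝔸) (hu₂ : u₂ ∈ U1 𝔸) (hu₃ : u₃ ∈ U1 𝔸) (hu₄ : u₄ ∈ U1 𝔸) {δ₂ δ₃ δ₄ : ℝ}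
    (hδ₂ : ‖((((g * hol V₀ x (seg κ L))⁻¹ * (u₁ * g') : 𝔸ˣ)) : 𝔸) - 1‖ ≤ δ₂)
    (hδ₃ : ‖((((g * (hol V₀ x (seg κ L) * hol V₀ (x + (L : ℤ) • e κ) (seg μ L) * (hol V₀ (x + (L : ℤ) • e μ) (seg κ L))⁻¹))⁻¹
              * (u₁ * u₂ * u₃⁻¹ * g'') : 𝔸ˣ)) : 𝔸) - 1‖ ≤ δ₃)
    (hδ₄ : ‖((((g * (hol V₀ x (seg κ L) * hol V₀ (x + (L : ℤ) • e κ) (seg μ L) * (hol V₀ (x + (L : ℤ) • e μ) (seg κ L))⁻¹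
              * (hol V₀ x (seg μ L))⁻¹))⁻¹ * (u₁ * u₂ * u₃⁻¹ * u₄⁻¹ * g) : 𝔸ˣ)) : 𝔸) - 1‖ ≤ δ₄) :
    ‖( conjR g (tsum V₀ A x (seg κ L))
        + conjR (u₁ * g') (tsum V₀ A (x + (L : ℤ) • e κ) (seg μ L))
        - conjR (u₁ * u₂ * u₃⁻¹ * g'') (tsum V₀ A (x + (L : ℤ) • e μ) (seg κ L))
        - conjR (u₁ * u₂ * u₃⁻¹ * u₄⁻¹ * g) (tsum V₀ A x (seg μ L)) )
      - conjR g (tsum V₀ A x (rectWord κ μ L L))‖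
      ≤ 2 * (δ₂ * ‖tsum V₀ A (x + (L : ℤ) • e κ) (seg μ L)‖ + δ₃ * ‖tsum V₀ A (x + (L : ℤ) • e μ) (seg κ L)‖
          + δ₄ * ‖tsum V₀ A x (seg μ L)‖) := by
  -- abbreviations
  set S₁ := tsum V₀ A x (seg κ L) with hS₁
  set S₂ := tsum V₀ A (x + (L : ℤ) • e κ) (seg μ L) with hS₂
  set S₃ := tsum V₀ A (x + (L : ℤ) • e μ) (seg κ L) with hS₃
  set S₄ := tsum V₀ A x (seg μ L) with hS₄
  set t₁ := hol V₀ x (seg κ L) with ht₁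
  set t₂ := hol V₀ (x + (L : ℤ) • e κ) (seg μ L) with ht₂
  set t₃ := hol V₀ (x + (L : ℤ) • e μ) (seg κ L) with ht₃
  set t₄ := hol V₀ x (seg μ L) with ht₄
  have ht₁m : t₁ ∈ U1 𝔸 := hol_mem hV₀ _ _
  have ht₂m : t₂ ∈ U1 𝔸 := hol_mem hV₀ _ _
  have ht₃m : t₃ ∈ U1 𝔸 := hol_mem hV₀ _ _
  have ht₄m : t₄ ∈ U1 𝔸 := hol_mem hV₀ _ _
  -- the transported boundary sum in four sides
  have hZ : conjR g (tsum V₀ A x (rectWord κ μ L L))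
      = conjR g S₁ + conjR (g * t₁) S₂ - conjR (g * (t₁ * t₂ * t₃⁻¹)) S₃ - conjR (g * (t₁ * t₂ * t₃⁻¹ * t₄⁻¹)) S₄ := by
    rw [tsum_rectWord V₀ A x κ μ L L, conjR_sub, conjR_sub, conjR_add, ← conjR_mul_left, ← conjR_mul_left, ← conjR_mul_left]
  rw [hZ]
  have hre : conjR g S₁ + conjR (u₁ * g') S₂ - conjR (u₁ * u₂ * u₃⁻¹ * g'') S₃ - conjR (u₁ * u₂ * u₃⁻¹ * u₄⁻¹ * g) S₄
      - (conjR g S₁ + conjR (g * t₁) S₂ - conjR (g * (t₁ * t₂ * t₃⁻¹)) S₃ - conjR (g * (t₁ * t₂ * t₃⁻¹ * t₄⁻¹)) S₄)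
      = (conjR (u₁ * g') S₂ - conjR (g * t₁) S₂)
        - (conjR (u₁ * u₂ * u₃⁻¹ * g'') S₃ - conjR (g * (t₁ * t₂ * t₃⁻¹)) S₃)
        - (conjR (u₁ * u₂ * u₃⁻¹ * u₄⁻¹ * g) S₄ - conjR (g * (t₁ * t₂ * t₃⁻¹ * t₄⁻¹)) S₄) := by abel
  rw [hre]
  -- the three transport comparisons
  have h2 := norm_conjR_sub_conjR_le ((U1 𝔸).mul_mem hu₁ hg') ((U1 𝔸).mul_mem hg ht₁m) hδ₂ S₂
  have h3 := norm_conjR_sub_conjR_le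
    ((U1 𝔸).mul_mem ((U1 𝔸).mul_mem ((U1 𝔸).mul_mem hu₁ hu₂) ((U1 𝔸).inv_mem hu₃)) hg'')
    ((U1 𝔸).mul_mem hg ((U1 𝔸).mul_mem ((U1 𝔸).mul_mem ht₁m ht₂m) ((U1 𝔸).inv_mem ht₃m))) hδ₃ S₃
  have h4 := norm_conjR_sub_conjR_le
    ((U1 𝔸).mul_mem ((U1 𝔸).mul_mem ((U1 𝔸).mul_mem ((U1 𝔸).mul_mem hu₁ hu₂) ((U1 𝔸).inv_mem hu₃)) ((U1 𝔸).inv_mem hu₄)) hg)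
    ((U1 𝔸).mul_mem hg ((U1 𝔸).mul_mem ((U1 𝔸).mul_mem ((U1 𝔸).mul_mem ht₁m ht₂m) ((U1 𝔸).inv_mem ht₃m))
      ((U1 𝔸).inv_mem ht₄m))) hδ₄ S₄
  have t1 := norm_sub_le
    (conjR (u₁ * g') S₂ - conjR (g * t₁) S₂ - (conjR (u₁ * u₂ * u₃⁻¹ * g'') S₃ - conjR (g * (t₁ * t₂ * t₃⁻¹)) S₃))
    (conjR (u₁ * u₂ * u₃⁻¹ * u₄⁻¹ * g) S₄ - conjR (g * (t₁ * t₂ * t₃⁻¹ * t₄⁻¹)) S₄)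
  have t2 := norm_sub_le (conjR (u₁ * g') S₂ - conjR (g * t₁) S₂)
    (conjR (u₁ * u₂ * u₃⁻¹ * g'') S₃ - conjR (g * (t₁ * t₂ * t₃⁻¹)) S₃)
  linarith

end Discrepancy

/-! ## §5 Lemma CS (ii) at `k = 1`, the bound: the `hX` shape of the counting -/

section Bound

variable (L : ℕ) {V₀ : Site d → Fin d → 𝔸ˣ} (hV₀ : ∀ x κ, V₀ x κ ∈ U1 𝔸) (A : Site d → Fin d → 𝔸)

omit [CompleteSpace 𝔸] in
include hV₀ in
/-- **LEMMA CS (ii) AT ONE STEP — THE PER-PLAQUETTE BOUND.**  For the coarse plaquette `P = (q; κ, μ)`, coarse bond variables `u₁ … u₄ ∈ U1`, and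
a uniform bound `δ` on the three closed-loop letters of §4 at every block point `x_r = q + r` (with the tree contours `V₀(Γ_{q,x_r})`,
`V₀(Γ_{q+Le_κ, x_r+Le_κ})`, `V₀(Γ_{q+Le_μ, x_r+Le_μ})` as `g, g′, g″`):
`‖(Q₀A)_{c₁} + R(u₁)(Q₀A)_{c₂} − R(u₁u₂u₃⁻¹)(Q₀A)_{c₃} − R(u₁u₂u₃⁻¹u₄⁻¹)(Q₀A)_{c₄}‖ ≤
Σ_r L^{−(d+1)}·(‖(R_{0,x_r}A)(∂S_{x_r}(P))‖ + 2δ·(Σ_{i<L}‖A(x_r+Le_κ+ie_μ, μ)‖ + Σ_{i<L}‖A(x_r+Le_μ+ie_κ, κ)‖ + Σ_{i<L}‖A(x_r+ie_μ, μ)‖))` — the shape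
`|X P| ≤ Σ_x w·(a_{P,x} + ε·Σ_{b∈T(P,x)} v·|A b|)` of `CovariantStokesCounting.sum_sq_le_of_blockAverage_bound`. [folklore] -/
theorem norm_coarseCurl_Q0cov_le (q : Site d) (κ μ : Fin d) {u₁ u₂ u₃ u₄ : 𝔸ˣ}
    (hu₁ : u₁ ∈ U1 𝔸) (hu₂ : u₂ ∈ U1 𝔸) (hu₃ : u₃ ∈ U1 𝔸) (hu₄ : u₄ ∈ U1 𝔸) {δ : ℝ} (hδ : 0 ≤ δ)
    (hδ₂ : ∀ r : Fin d → Fin L,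
      ‖((((hol V₀ q (treeWord (boxVec L r)) * hol V₀ (q + boxVec L r) (seg κ L))⁻¹
          * (u₁ * hol V₀ (q + (L : ℤ) • e κ) (treeWord (boxVec L r))) : 𝔸ˣ)) : 𝔸) - 1‖ ≤ δ)
    (hδ₃ : ∀ r : Fin d → Fin L,
      ‖((((hol V₀ q (treeWord (boxVec L r)) * (hol V₀ (q + boxVec L r) (seg κ L)
            * hol V₀ (q + boxVec L r + (L : ℤ) • e κ) (seg μ L) * (hol V₀ (q + boxVec L r + (L : ℤ) • e μ) (seg κ L))⁻¹))⁻¹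
          * (u₁ * u₂ * u₃⁻¹ * hol V₀ (q + (L : ℤ) • e μ) (treeWord (boxVec L r))) : 𝔸ˣ)) : 𝔸) - 1‖ ≤ δ)
    (hδ₄ : ∀ r : Fin d → Fin L,
      ‖((((hol V₀ q (treeWord (boxVec L r)) * (hol V₀ (q + boxVec L r) (seg κ L)
            * hol V₀ (q + boxVec L r + (L : ℤ) • e κ) (seg μ L) * (hol V₀ (q + boxVec L r + (L : ℤ) • e μ) (seg κ L))⁻¹
            * (hol V₀ (q + boxVec L r) (seg μ L))⁻¹))⁻¹
          * (u₁ * u₂ * u₃⁻¹ * u₄⁻¹ * hol V₀ q (treeWord (boxVec L r))) : 𝔸ˣ)) : 𝔸) - 1‖ ≤ δ) :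
    ‖Q0cov L V₀ A q κ + conjR u₁ (Q0cov L V₀ A (q + (L : ℤ) • e κ) μ)
      - conjR (u₁ * u₂ * u₃⁻¹) (Q0cov L V₀ A (q + (L : ℤ) • e μ) κ)
      - conjR (u₁ * u₂ * u₃⁻¹ * u₄⁻¹) (Q0cov L V₀ A q μ)‖
    ≤ ∑ r : Fin d → Fin L, ((L : ℝ) ^ (d + 1))⁻¹ *
        ( ‖tsum V₀ A (q + boxVec L r) (rectWord κ μ L L)‖
          + 2 * δ * ( ∑ i ∈ Finset.range L, ‖A (q + boxVec L r + (L : ℤ) • e κ + (i : ℤ) • e μ) μ‖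
                    + ∑ i ∈ Finset.range L, ‖A (q + boxVec L r + (L : ℤ) • e μ + (i : ℤ) • e κ) κ‖
                    + ∑ i ∈ Finset.range L, ‖A (q + boxVec L r + (i : ℤ) • e μ) μ‖ ) ) := by
  rw [coarseCurl_Q0cov_eq_sum L V₀ A q κ μ u₁ u₂ u₃ u₄]
  refine (norm_sum_le _ _).trans (Finset.sum_le_sum fun r _ => ?_)
  have hLpos : 0 ≤ ((L : ℝ) ^ (d + 1))⁻¹ := by positivity
  rw [norm_smul, Real.norm_of_nonneg hLpos]
  refine mul_le_mul_of_nonneg_left ?_ hLpos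
  set x := q + boxVec L r with hx
  set g := hol V₀ q (treeWord (boxVec L r)) with hg
  have hgm : g ∈ U1 𝔸 := hol_mem hV₀ _ _
  have hg'm : hol V₀ (q + (L : ℤ) • e κ) (treeWord (boxVec L r)) ∈ U1 𝔸 := hol_mem hV₀ _ _
  have hg''m : hol V₀ (q + (L : ℤ) • e μ) (treeWord (boxVec L r)) ∈ U1 𝔸 := hol_mem hV₀ _ _
  -- split off the transported boundary sum
  have hY := norm_Y_sub_conjR_Z_le hV₀ A x κ μ L hgm hg'm hg''m hu₁ hu₂ hu₃ hu₄ (hδ₂ r) (hδ₃ r) (hδ₄ r)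
  have hZ : ‖conjR g (tsum V₀ A x (rectWord κ μ L L))‖ ≤ ‖tsum V₀ A x (rectWord κ μ L L)‖ := norm_conjR_le hgm _
  have hS₂ := norm_tsum_seg_le_sum hV₀ A μ L (x + (L : ℤ) • e κ)
  have hS₃ := norm_tsum_seg_le_sum hV₀ A κ L (x + (L : ℤ) • e μ)
  have hS₄ := norm_tsum_seg_le_sum hV₀ A μ L x
  have htri := norm_add_le
    (( conjR g (tsum V₀ A x (seg κ L))
        + conjR (u₁ * hol V₀ (q + (L : ℤ) • e κ) (treeWord (boxVec L r))) (tsum V₀ A (x + (L : ℤ) • e κ) (seg μ L))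
        - conjR (u₁ * u₂ * u₃⁻¹ * hol V₀ (q + (L : ℤ) • e μ) (treeWord (boxVec L r))) (tsum V₀ A (x + (L : ℤ) • e μ) (seg κ L))
        - conjR (u₁ * u₂ * u₃⁻¹ * u₄⁻¹ * g) (tsum V₀ A x (seg μ L)) )
      - conjR g (tsum V₀ A x (rectWord κ μ L L)))
    (conjR g (tsum V₀ A x (rectWord κ μ L L)))
  rw [sub_add_cancel] at htri
  have m2 := mul_le_mul_of_nonneg_left hS₂ hδ
  have m3 := mul_le_mul_of_nonneg_left hS₃ hδ
  have m4 := mul_le_mul_of_nonneg_left hS₄ hδ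
  linarith

end Bound

end Summit.QuantumFields.BalabanUV.T4Continuum.NE7b.OneStepCovariantStokes

end
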